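import Mathlib.Analysis.InnerProductSpace.PiL2
import Mathlib.Analysis.Normed.Algebra.Exponential
import Mathlib.Analysis.SpecialFunctions.Exponential
import Mathlib.Analysis.Calculus.MeanValue
import Mathlib.Analysis.Calculus.FDeriv.Pi
import Mathlib.Analysis.Calculus.Deriv.Comp
import Mathlib.Analysis.Calculus.Deriv.Mul
import Summits.CriticalPhenomena.Ising3DConformalLimit.Theorems.PlantedPinningMoebiusLimitExistsRotationGenerator
import HarnessLib

/-!
# Infinitesimal invariance under the rotations about the vertical axis

Stub `Z3'` of line Sketch (skeleton v24) for the crux `MoebiusLimitExists` of route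
`PlantedPinning` (`Summit.CriticalPhenomena.Ising3DConformalLimit`, stmt-CriticalPhenomena-1344).
For a level `F : (ℝ³)ⁿ → ℝ` that is invariant under the diagonal action `y ↦ (R yᵢ)ᵢ` of every
linear isometric isomorphism `R` of `ℝ³ = EuclideanSpace ℝ (Fin 3)` FIXING the vertical unit vector
`e₀ = EuclideanSpace.single 0 1`, and differentiable at `x`, the derivative of `F` at `x` along the
generator of the rotations about the `e₀`-axis vanishes:
`DF(x)[(⟪e₂, xᵢ⟫ e₁ − ⟪e₁, xᵢ⟫ e₂)ᵢ] = 0` (`stub_fderiv_axialRotationGenerator`), where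
`e₁ = EuclideanSpace.single 1 1`, `e₂ = EuclideanSpace.single 2 1`.

Proof: the argument of stub `Z3` (`MoebiusLimitExistsSketchV16.stub_fderiv_rotationGenerator`,
file `PlantedPinningMoebiusLimitExistsRotationGenerator.lean`, whose helper lemmas are reused):
the generator `A v := ⟪e₂, v⟫ e₁ − ⟪e₁, v⟫ e₂` is skew, so each `e^{tA}`
(`NormedSpace.exp (t • A)` in the Banach algebra of bounded operators) is a linear isometric
isomorphism (`exists_linearIsometryEquiv_eq_exp_smul`); the one new point is that it FIXES `e₀`,
because `A e₀ = 0` (`⟪e₂, e₀⟫ = ⟪e₁, e₀⟫ = 0`) and a vector killed by the generator is fixed by the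
whole one-parameter group (`exp_smul_clm_apply_eq_self_of_apply_eq_zero`: the orbit
`s ↦ e^{sB} v` has velocity `e^{sB} (B v) = 0`, hence is constant). So `t ↦ F ((e^{tA} xᵢ)ᵢ)` is
constant, while the chain rule computes its derivative at `t = 0` as `DF(x)[(A xᵢ)ᵢ]`; derivatives
are unique.

## References

Standard (S. Lie / E. Noether: invariance under a one-parameter group kills the derivative along
its generator; here for the axial rotation group `SO(2) ⊂ SO(3)` acting diagonally). [folklore]

## Design choices

* As in the `Z3` file, the operator algebra is done for a general real Hilbert space `E` and only
  instantiated at `EuclideanSpace ℝ (Fin 3)` by `exact` (on `PiLp` the scalar action on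
  `E →L[ℝ] E` is found along two instance paths that agree only up to unfolding).
* No new definitions; the generator is the bounded operator
  `(innerSL ℝ e₂).smulRight e₁ - (innerSL ℝ e₁).smulRight e₂`, kept inline.
* NOT here: the order-2 kernel (stub K0) and the Euler identity (stub E1) of the same skeleton.
-/

noncomputable section

open scoped RealInnerProductSpace

namespace Summit.CriticalPhenomena.Ising3DConformalLimit.MoebiusLimitExistsSketchV24

open Summit.CriticalPhenomena.Ising3DConformalLimit.MoebiusLimitExistsSketchV16

variable {E : Type*} [NormedAddCommGroup E] [InnerProductSpace ℝ E]

/-- A vector killed by the generator is fixed by the whole one-parameter group: if `B v = 0` then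
`e^{tB} v = v` for every `t` (the orbit `s ↦ e^{sB} v` has velocity `e^{sB} (B v) = 0` everywhere,
hence is constant, and `e^{0} v = v`). [folklore] -/
theorem exp_smul_clm_apply_eq_self_of_apply_eq_zero [CompleteSpace E] (B : E →L[ℝ] E) {v : E}
    (hv : B v = 0) (t : ℝ) : NormedSpace.exp (t • B) v = v := by
  have hd : ∀ s : ℝ, HasDerivAt (fun u : ℝ => NormedSpace.exp (u • B) v) 0 s := fun s => by
    have h := (hasDerivAt_exp_smul_const (𝕂 := ℝ) B s).clm_apply (hasDerivAt_const s v)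
    simpa [hv] using h
  have hconst := is_const_of_deriv_eq_zero (fun s => (hd s).differentiableAt)
    (fun s => (hd s).deriv) t 0
  rw [hconst]
  exact exp_zero_smul_clm_apply B v

/-- **Infinitesimal axial rotation invariance (stub `Z3'` of line Sketch, skeleton v24).** Let
`F : (ℝ³)ⁿ → ℝ` be invariant under the diagonal action of every linear isometric isomorphism of
`ℝ³` fixing `e₀ = EuclideanSpace.single 0 1`, `F ((R yᵢ)ᵢ) = F y` whenever `R e₀ = e₀`, and
differentiable at the configuration `x`. Then the derivative of `F` at `x` along the generator of
the rotations about the `e₀`-axis vanishes: `DF(x)[(⟪e₂, xᵢ⟫ e₁ − ⟪e₁, xᵢ⟫ e₂)ᵢ] = 0` with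
`e₁ = single 1 1`, `e₂ = single 2 1`. Proof: with the skew generator `A v = ⟪e₂, v⟫ e₁ − ⟪e₁, v⟫ e₂`,
which kills `e₀`, the curve `t ↦ (e^{tA} xᵢ)ᵢ` consists of diagonal images of `x` under the linear
isometric isomorphisms `e^{tA}` (`exists_linearIsometryEquiv_eq_exp_smul`), each of which fixes
`e₀` (`exp_smul_clm_apply_eq_self_of_apply_eq_zero`), so `F` is constant along it, while the chain
rule computes its derivative at `t = 0` as `DF(x)[(A xᵢ)ᵢ]`; derivatives are unique. [folklore] -/
theorem stub_fderiv_axialRotationGenerator : ∀ (n : ℕ) (F : (Fin n → EuclideanSpace ℝ (Fin 3)) → ℝ)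
    (x : Fin n → EuclideanSpace ℝ (Fin 3)), DifferentiableAt ℝ F x →
    (∀ (R : EuclideanSpace ℝ (Fin 3) ≃ₗᵢ[ℝ] EuclideanSpace ℝ (Fin 3)),
      R (EuclideanSpace.single 0 1) = EuclideanSpace.single 0 1 →
      ∀ y : Fin n → EuclideanSpace ℝ (Fin 3), F (fun i => R (y i)) = F y) →
    fderiv ℝ F x (fun i => inner ℝ (EuclideanSpace.single 2 1 : EuclideanSpace ℝ (Fin 3)) (x i) •
        (EuclideanSpace.single 1 1 : EuclideanSpace ℝ (Fin 3)) -
      inner ℝ (EuclideanSpace.single 1 1 : EuclideanSpace ℝ (Fin 3)) (x i) •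
        (EuclideanSpace.single 2 1 : EuclideanSpace ℝ (Fin 3))) = 0 := by
  intro n F x hF hR
  -- the generator `A v = ⟪e₂, v⟫ e₁ - ⟪e₁, v⟫ e₂`, as an (opaque) bounded operator
  obtain ⟨A, hA⟩ : ∃ A : EuclideanSpace ℝ (Fin 3) →L[ℝ] EuclideanSpace ℝ (Fin 3),
      A = (innerSL ℝ (EuclideanSpace.single 2 1 : EuclideanSpace ℝ (Fin 3))).smulRight
          (EuclideanSpace.single 1 1 : EuclideanSpace ℝ (Fin 3)) -
        (innerSL ℝ (EuclideanSpace.single 1 1 : EuclideanSpace ℝ (Fin 3))).smulRight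
          (EuclideanSpace.single 2 1 : EuclideanSpace ℝ (Fin 3)) := ⟨_, rfl⟩
  have hAv : ∀ v, A v = ⟪(EuclideanSpace.single 2 1 : EuclideanSpace ℝ (Fin 3)), v⟫ •
        (EuclideanSpace.single 1 1 : EuclideanSpace ℝ (Fin 3)) -
      ⟪(EuclideanSpace.single 1 1 : EuclideanSpace ℝ (Fin 3)), v⟫ •
        (EuclideanSpace.single 2 1 : EuclideanSpace ℝ (Fin 3)) := fun v => by
    rw [hA]
    exact rotationGenerator_apply _ _ v
  have hskew : ∀ v, ⟪A v, v⟫ = 0 := fun v => by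
    rw [hA]
    exact inner_rotationGenerator_self _ _ v
  -- the generator kills the vertical axis: `A e₀ = ⟪e₂, e₀⟫ e₁ - ⟪e₁, e₀⟫ e₂ = 0`
  have hA0 : A (EuclideanSpace.single 0 1) = 0 := by
    rw [hAv, EuclideanSpace.inner_single_left, EuclideanSpace.inner_single_left]
    simp
  -- the rotation curve `γ t = (e^{tA} xᵢ)ᵢ` through `γ 0 = x`, with `γ' 0 = (A xᵢ)ᵢ`
  have hγ : HasDerivAt (fun t : ℝ => fun i => NormedSpace.exp (t • A) (x i))
      (fun i => A (x i)) 0 := by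
    rw [hasDerivAt_pi]
    intro i
    exact hasDerivAt_exp_smul_clm_apply_zero A (x i)
  have hγ0 : x = (fun i => NormedSpace.exp ((0 : ℝ) • A) (x i)) := by
    funext i
    exact (exp_zero_smul_clm_apply A (x i)).symm
  -- chain rule: `d/dt|₀ F (γ t) = DF(x)[(A xᵢ)ᵢ]`
  have hcomp : HasDerivAt (F ∘ fun t : ℝ => fun i => NormedSpace.exp (t • A) (x i))
      (fderiv ℝ F x (fun i => A (x i))) 0 :=
    hF.hasFDerivAt.comp_hasDerivAt_of_eq (0 : ℝ) hγ hγ0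
  -- axial rotation invariance: `F ∘ γ` is the constant `F x` (each `e^{tA}` fixes `e₀`)
  have hconst : (F ∘ fun t : ℝ => fun i => NormedSpace.exp (t • A) (x i)) = fun _ => F x := by
    funext t
    obtain ⟨L, hL⟩ := exists_linearIsometryEquiv_eq_exp_smul hskew t
    have hL0 : L (EuclideanSpace.single 0 1) = EuclideanSpace.single 0 1 := by
      rw [hL]
      exact exp_smul_clm_apply_eq_self_of_apply_eq_zero A hA0 t
    have h := hR L hL0 x
    simp only [hL] at h
    exact h
  rw [hconst] at hcomp
  have h0 : fderiv ℝ F x (fun i => A (x i)) = 0 := hcomp.unique (hasDerivAt_const (0 : ℝ) (F x))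
  have hfun : (fun i => ⟪(EuclideanSpace.single 2 1 : EuclideanSpace ℝ (Fin 3)), x i⟫ •
        (EuclideanSpace.single 1 1 : EuclideanSpace ℝ (Fin 3)) -
      ⟪(EuclideanSpace.single 1 1 : EuclideanSpace ℝ (Fin 3)), x i⟫ •
        (EuclideanSpace.single 2 1 : EuclideanSpace ℝ (Fin 3))) = fun i => A (x i) := by
    funext i
    exact (hAv (x i)).symm
  rw [hfun]
  exact h0

end Summit.CriticalPhenomena.Ising3DConformalLimit.MoebiusLimitExistsSketchV24

end
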